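import Summits.NavierStokesRegularity.NavierStokesRegularity.Theorems.PerpetualPumpAveragedTypeIBlowupPulseTools

/-!
# Crux `PerpetualPump.AveragedTypeIBlowup` (stmt-NavierStokesRegularity-1835), line `Sketch`:
# tools for the stub `pulse` — the dead phase after the pulse

One step of the proof of the registered stub `stub_pulse` (the TRANSFER PULSE of the forced Toda
gate `b' = -b - w² + f₁`, `w' = w(b - β - 1) + f₂`, `β' = -q⁴β + w² + f₃`, `|fᵢ| ≤ φ ≤ 1/2000`):

* `pulse_dead` (= registered sub-goal `stub_pulseDead`) — the DEAD PHASE: from a time `T` where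
  `|w| ≤ 1`, `b ≤ 83/5000`, `b ≥ -43/500`, `β ≥ 0.996 B` up to the end `σ₁ ≤ 1/10` of the window,
  `b ≤ 1/50` (barrier), `β ≥ 0.88 B` (mean value inequality, `β' ≥ -1.111 B`), the bond is damped
  at rate `≥ 0.88 B` so `|w| ≤ 1 + 1/(1000 B)` (`pulse_decay_abs`), hence `β' < 0`, and
  `b ≥ -0.09 - 1.1 (σ - T) ≥ -1/5` (lower barrier).

## References

Folklore ODE comparison arguments; T. Tao, *Finite time blowup for an averaged three-dimensional
Navier–Stokes equation*, J. Amer. Math. Soc. 29 (2016), 601–674, §5.4–5.5.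
-/

noncomputable section

-- the summit namespace `…NavierStokesRegularity.NavierStokesRegularity…` is the tree convention
set_option linter.dupNamespace false

open Set Filter Topology

namespace Summit.NavierStokesRegularity.NavierStokesRegularity.Theorems.PerpetualPumpAveragedTypeIBlowup

/-- **The dead phase after the pulse.** From a time `T` where `|w| ≤ 1`, `b ≤ 83/5000`,
`b ≥ -43/500` and `β ≥ 0.996 B` on, up to the end `σ₁ ≤ 1/10` of the window: `b ≤ 1/50`
(barrier), `β ≥ 0.88 B` (mean value inequality, `β' ≥ -1.111 B`), so the bond is damped at rate
`≥ 0.88 B` and `|w| ≤ 1 + 1/(1000 B)` (`pulse_decay_abs`), whence `β' = -q⁴β + w² + f₃ < 0`, and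
`b ≥ -0.09 - 1.1 (σ - T) ≥ -1/5` (lower barrier). [folklore] -/
theorem pulse_dead (b w β f₁ f₂ f₃ : ℝ → ℝ) (B q4 φ σ₁ T : ℝ)
    (hB : 10 ^ 4 ≤ B) (hq1 : 1 ≤ q4) (hq2 : q4 ≤ 111 / 100) (hφ0 : 0 ≤ φ) (hφ1 : φ ≤ 1 / 2000)
    (hσ₁ : σ₁ ≤ 1 / 10)
    (hbc : ContinuousOn b (Icc 0 σ₁)) (hwc : ContinuousOn w (Icc 0 σ₁))
    (hβc : ContinuousOn β (Icc 0 σ₁))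
    (hbd : ∀ σ ∈ Ioo 0 σ₁, HasDerivAt b (-(b σ) - (w σ) ^ 2 + f₁ σ) σ)
    (hwd : ∀ σ ∈ Ioo 0 σ₁, HasDerivAt w (w σ * (b σ - β σ - 1) + f₂ σ) σ)
    (hβd : ∀ σ ∈ Ioo 0 σ₁, HasDerivAt β (-(q4 * β σ) + (w σ) ^ 2 + f₃ σ) σ)
    (hf : ∀ σ ∈ Icc 0 σ₁, |f₁ σ| ≤ φ ∧ |f₂ σ| ≤ φ ∧ |f₃ σ| ≤ φ)
    (hb0 : b 0 = B) (hw0 : w 0 = Real.sqrt B / 10) (hβ0 : |β 0| ≤ 1 / 50)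
    (hT0 : 0 < T) (hT1 : T ≤ σ₁) (hwT : |w T| ≤ 1) (hbT : b T ≤ 83 / 5000)
    (hbT' : -(43 / 500) ≤ b T) (hβT : 996 / 1000 * B ≤ β T) :
    ∀ σ ∈ Icc T σ₁, b σ ≤ 1 / 50 ∧ -(1 / 5) ≤ b σ ∧ 88 / 100 * B ≤ β σ ∧
      |w σ| ≤ 1 + 1 / (1000 * B) ∧ -(q4 * β σ) + (w σ) ^ 2 + f₃ σ < 0 := by
  have hB0 : 0 < B := lt_of_lt_of_le (by norm_num) hB
  have henv := pulse_envelope_energy b w β f₁ f₂ f₃ B q4 φ σ₁ hB hq1 hq2 hφ0 hφ1 hσ₁ hbc hwc hβc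
    hbd hwd hβd hf hb0 hw0 hβ0
  have hTI : Icc T σ₁ ⊆ Icc 0 σ₁ := Icc_subset_Icc_left hT0.le
  have hTI' : ∀ s ∈ Ioo T σ₁, s ∈ Ioo 0 σ₁ := fun s hs => ⟨hT0.trans hs.1, hs.2⟩
  -- `b ≤ 1/50`
  have hbhi : ∀ σ ∈ Icc T σ₁, b σ ≤ 1 / 50 := by
    refine pulse_barrier_upper (hbc.mono hTI) (by linarith) (fun s hs hlt => ⟨_, hbd s (hTI' s hs), ?_⟩)
    have h1 := (abs_le.1 (hf s (hTI (Ioo_subset_Icc_self hs))).1).2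
    nlinarith [sq_nonneg (w s)]
  -- `β ≥ 0.88 B`
  have hβlo : ∀ σ ∈ Icc T σ₁, 88 / 100 * B ≤ β σ := by
    intro σ hσ
    have key := pulse_image_sub_ge (f := β) (C := -(1111 / 1000 * B)) hσ.1
      (hβc.mono (Icc_subset_Icc hT0.le hσ.2)) (fun s hs => by
        have hs' : s ∈ Ioo 0 σ₁ := ⟨hT0.trans hs.1, hs.2.trans_le hσ.2⟩
        refine ⟨_, hβd s hs', ?_⟩
        obtain ⟨-, -, h3⟩ := hf s (Ioo_subset_Icc_self hs')
        obtain ⟨-, -, hβa, -⟩ := henv s (Ioo_subset_Icc_self hs')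
        have e0 : q4 * β s ≤ q4 * |β s| := mul_le_mul_of_nonneg_left (le_abs_self _) (by linarith)
        have e1 : q4 * |β s| ≤ 111 / 100 * (B + 1 / 100) := mul_le_mul hq2 hβa (abs_nonneg _) (by norm_num)
        nlinarith [sq_nonneg (w s), (abs_le.1 h3).1])
    have : 1111 / 1000 * B * (σ - T) ≤ 1111 / 1000 * B * (1 / 10) :=
      mul_le_mul_of_nonneg_left (by linarith [hσ.2, hσ.1]) (by positivity)
    nlinarith
  -- the damped bond
  have hwabs : ∀ σ ∈ Icc T σ₁, |w σ| ≤ 1 + 1 / (1000 * B) := by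
    intro σ hσ
    have hdec := pulse_decay_abs (x := w) (k := fun s => b s - β s - 1) (f := f₂) (K := 22 * B / 25)
      (by positivity) hφ0 (hwc.mono hTI) (fun s hs => hwd s (hTI' s hs))
      (fun s hs => by
        have h1 := hbhi s (Ioo_subset_Icc_self hs)
        have h2 := hβlo s (Ioo_subset_Icc_self hs)
        show b s - β s - 1 ≤ -(22 * B / 25)
        linarith)
      (fun s hs => (hf s (hTI (Ioo_subset_Icc_self hs))).2.1) σ hσ
    have h1 : |w T| * Real.exp (-(22 * B / 25 * (σ - T))) ≤ 1 := by
      have he : Real.exp (-(22 * B / 25 * (σ - T))) ≤ 1 := by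
        rw [Real.exp_le_one_iff]
        have : 0 ≤ 22 * B / 25 * (σ - T) := by nlinarith [hσ.1]
        linarith
      calc |w T| * Real.exp (-(22 * B / 25 * (σ - T))) ≤ 1 * 1 :=
            mul_le_mul hwT he (Real.exp_nonneg _) zero_le_one
        _ = 1 := by norm_num
    have h2 : φ / (22 * B / 25) ≤ 1 / (1000 * B) := by
      rw [div_le_div_iff₀ (by positivity) (by positivity)]
      nlinarith
    linarith
  intro σ hσ
  have hb := hbhi σ hσ
  have hβ := hβlo σ hσ
  have hw := hwabs σ hσ
  refine ⟨hb, ?_, hβ, hw, ?_⟩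
  · -- the lower barrier for `b + 0.09 + 1.1 (σ - T)`
    have key := pulse_barrier_lower (x := fun s => b s + (9 / 100 + 11 / 10 * (s - T))) (L := 0)
      (a := T) (c := σ₁) ((hbc.mono hTI).add (by fun_prop))
      (show 0 ≤ b T + (9 / 100 + 11 / 10 * (T - T)) by linarith)
      (fun s hs (hlt : b s + (9 / 100 + 11 / 10 * (s - T)) < 0) => by
        refine ⟨_, (hbd s (hTI' s hs)).add
          (((hasDerivAt_id s).sub_const T).const_mul (11 / 10) |>.const_add (9 / 100)), ?_⟩
        have h1 := (abs_le.1 (hf s (hTI (Ioo_subset_Icc_self hs))).1).1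
        have hsmall : 1 / (1000 * B) ≤ 1 / 10000000 := by
          rw [one_div_le_one_div (by positivity) (by norm_num)]; linarith
        have hws : |w s| ≤ 1 + 1 / 10000000 := (hwabs s (Ioo_subset_Icc_self hs)).trans (by linarith)
        have hws2 : (w s) ^ 2 ≤ (1 + 1 / 10000000) ^ 2 := by
          rw [← sq_abs]; exact pow_le_pow_left₀ (abs_nonneg _) hws 2
        norm_num at hws2
        simp only [mul_one]
        nlinarith [hs.1])
    have := key σ hσ
    have : 11 / 10 * (σ - T) ≤ 11 / 100 := by linarith [hσ.2, hσ.1]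
    linarith
  · have hsmall : 1 / (1000 * B) ≤ 1 / 10000000 := by
      rw [one_div_le_one_div (by positivity) (by norm_num)]; linarith
    have hws : |w σ| ≤ 1 + 1 / 10000000 := hw.trans (by linarith)
    have hws2 : (w σ) ^ 2 ≤ (1 + 1 / 10000000) ^ 2 := by
      rw [← sq_abs]; exact pow_le_pow_left₀ (abs_nonneg _) hws 2
    norm_num at hws2
    have h3 := (abs_le.1 (hf σ (hTI hσ)).2.2).2
    have : q4 * β σ ≥ 1 * (88 / 100 * B) := mul_le_mul hq1 hβ (by positivity) (by linarith)
    linarith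

/-- **Registered sub-goal `stub_pulseDead` of the stub `pulse`** (closed form of `pulse_dead`):
the dead phase after the pulse. [folklore] -/
theorem stub_pulseDead :
    ∀ (b w β f₁ f₂ f₃ : ℝ → ℝ) (B q4 φ σ₁ T : ℝ),
      10 ^ 4 ≤ B → 1 ≤ q4 → q4 ≤ 111 / 100 → 0 ≤ φ → φ ≤ 1 / 2000 → σ₁ ≤ 1 / 10 →
      ContinuousOn b (Icc 0 σ₁) → ContinuousOn w (Icc 0 σ₁) → ContinuousOn β (Icc 0 σ₁) →
      (∀ σ ∈ Ioo 0 σ₁, HasDerivAt b (-(b σ) - (w σ) ^ 2 + f₁ σ) σ) →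
      (∀ σ ∈ Ioo 0 σ₁, HasDerivAt w (w σ * (b σ - β σ - 1) + f₂ σ) σ) →
      (∀ σ ∈ Ioo 0 σ₁, HasDerivAt β (-(q4 * β σ) + (w σ) ^ 2 + f₃ σ) σ) →
      (∀ σ ∈ Icc 0 σ₁, |f₁ σ| ≤ φ ∧ |f₂ σ| ≤ φ ∧ |f₃ σ| ≤ φ) → b 0 = B → w 0 = Real.sqrt B / 10 →
      |β 0| ≤ 1 / 50 → 0 < T → T ≤ σ₁ → |w T| ≤ 1 → b T ≤ 83 / 5000 → -(43 / 500) ≤ b T →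
      996 / 1000 * B ≤ β T →
      ∀ σ ∈ Icc T σ₁, b σ ≤ 1 / 50 ∧ -(1 / 5) ≤ b σ ∧ 88 / 100 * B ≤ β σ ∧
        |w σ| ≤ 1 + 1 / (1000 * B) ∧ -(q4 * β σ) + (w σ) ^ 2 + f₃ σ < 0  :=
  fun b w β f₁ f₂ f₃ B q4 φ σ₁ T hB hq1 hq2 hφ0 hφ1 hσ₁ hbc hwc hβc hbd hwd hβd hf hb0 hw0 hβ0 hT0
      hT1 hwT hbT hbT' hβT =>
    pulse_dead b w β f₁ f₂ f₃ B q4 φ σ₁ T hB hq1 hq2 hφ0 hφ1 hσ₁ hbc hwc hβc hbd hwd hβd hf hb0 hw0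
      hβ0 hT0 hT1 hwT hbT hbT' hβT

end Summit.NavierStokesRegularity.NavierStokesRegularity.Theorems.PerpetualPumpAveragedTypeIBlowup

end
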